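import Mathlib
import Summits.CriticalPhenomena.CardyFormulaZ2.Theorems.CardyWhiteToColouredDriftBoundPlackettDefs
import Summits.CriticalPhenomena.CardyFormulaZ2.Theorems.CardyWhiteToColouredDriftBoundPlackettVar
import Summits.CriticalPhenomena.CardyFormulaZ2.Theorems.CardyWhiteToColouredDriftBoundWindowHardness
import Summits.CriticalPhenomena.CardyFormulaZ2.Theorems.CardyWhiteToColouredNoiseDiscretisationCrossing
import Summits.CriticalPhenomena.CardyFormulaZ2.Theorems.CardyWhiteToColouredNoiseDiscretisationDiscrepancy

/-!
# Stub `stub_locality` (S0) — locality and scaling of the `η = 0` event of the normalised field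

Helper file for crux item `DriftBound` (stmt-CriticalPhenomena-4596, decl
`Summit.CriticalPhenomena.CardyFormulaZ2.Theses.CardyWhiteToColoured.DriftBound`) of route
`CardyWhiteToColoured` (`CardyFormulaZ2`), line `registered` (`Cruxes/DriftBound/Lines/birth.lean`,
skeleton v4, lead c3), stub S0 = locality and scaling: the `η = 0` event of the normalised field on
the inner edges is the crux's lattice term. For a conformal rectangle `R`, mesh `δ > 0` and width
`σ > 0`,

`P_ξ({e ∈ innerEdges R.carrier δ | normNoise σ ξ (m_1 e) > 0} ∈ discreteCrossing R_δ)
  = smoothedCrossingProb (σ δ) δ R.carrier (R.arc 0) (R.arc 2) = P^latt_{σδ,δ}(R)`.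

The two events (sets of noises `ξ`) coincide:
* scaling — `signConfig (σ δ) δ = signConfig σ 1` (`signConfig_scale`: only `σ = s/δ` matters for
  the signs of the smoothed noise read at the medial points);
* positivity of the normalisation — `normNoise σ ξ x > 0 ↔ smoothedNoise σ 1 ξ x > 0`
  (`pl_normNoise_pos_iff`, the variance `noiseVar σ x` is positive);
* finiteness — the carrier of `R` is bounded, so its inner edge set at mesh `δ` is finite
  (`exists_finset_innerE_subset`) and `innerEdges R.carrier δ` enumerates it
  (`mem_innerEdges_iff_of_finite`);
* locality — the discrete crossing event of `R_δ` only depends on the states of the inner edges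
  (`mem_discreteCrossing_iff_of_inter_innerE_eq`), and the two configurations have the same trace
  on the inner edges.

References: D. Beliaev, S. Muirhead, A. Rivera, Ann. Probab. 48 (2020), §2.2;
S. Muirhead, H. Vanneuville, Ann. Inst. H. Poincaré Probab. Stat. 56 (2020), §2.1.
-/

noncomputable section

namespace Summit.CriticalPhenomena.CardyFormulaZ2.Cruxes.DriftBound.Birth

open Set MeasureTheory
open Literature.Probability.LatticeModels Literature.Probability.Percolation
open Literature.Probability.RandomPlanarGeometry
open Summit.CriticalPhenomena.CardyFormulaZ2.Theorems.WhiteToColoured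

/-- The inner edge set of a conformal rectangle at a positive mesh is finite (the carrier is
bounded, `exists_finset_innerE_subset`). -/
theorem lo_innerEdgeSet_finite (R : ConformalRectangle) {δ : ℝ} (hδ : 0 < δ) :
    (innerEdgeSet R.carrier δ).Finite := by
  obtain ⟨ρ, hΩ⟩ := (Metric.isBounded_iff_subset_closedBall (0 : ℂ)).1 R.isBounded
  obtain ⟨I, hI, -⟩ := exists_finset_innerE_subset (le_max_left 0 ρ)
    (hΩ.trans (Metric.closedBall_subset_closedBall (le_max_right 0 ρ))) hδ
  exact I.finite_toSet.subset hI

/-- For `σ > 0` and a finite inner edge set, the positive configuration of the normalised field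
read on `innerEdges Ω δ` and the sign configuration `signConfig σ 1 ξ` have the same trace on the
inner edges. -/
theorem lo_inter_innerEdgeSet_eq {Ω : Set ℂ} {δ σ : ℝ} (hfin : (innerEdgeSet Ω δ).Finite)
    (hσ : 0 < σ) (ξ : (zdGraph 2).edgeSet → ℝ) :
    {e : Sym2 (Site 2) | e ∈ innerEdges Ω δ ∧ 0 < normNoise σ ξ (medialPoint 1 e)} ∩
        innerEdgeSet Ω δ =
      signConfig σ 1 ξ ∩ innerEdgeSet Ω δ := by
  ext e
  simp only [mem_inter_iff, mem_setOf_eq, mem_innerEdges_iff_of_finite hfin, mem_innerEdgeSet_iff,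
    mem_signConfig_iff, pl_normNoise_pos_iff hσ]
  tauto

/-- For `σ > 0` and a finite inner edge set, the `η = 0` event of the normalised field on the inner
edges is the pull-back of the crossing event under `signConfig σ 1` (locality of
`discreteCrossing` on the inner edges). -/
theorem lo_event_eq_preimage {Ω : Set ℂ} {δ σ : ℝ} (hfin : (innerEdgeSet Ω δ).Finite)
    (hσ : 0 < σ) (A B : Set ℂ) :
    {ξ : (zdGraph 2).edgeSet → ℝ |
        {e : Sym2 (Site 2) | e ∈ innerEdges Ω δ ∧ 0 < normNoise σ ξ (medialPoint 1 e)} ∈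
          discreteCrossing Ω δ A B} =
      signConfig σ 1 ⁻¹' discreteCrossing Ω δ A B := by
  ext ξ
  simp only [mem_setOf_eq, mem_preimage]
  exact mem_discreteCrossing_iff_of_inter_innerE_eq (lo_inter_innerEdgeSet_eq hfin hσ ξ)

/-- **Stub S0 — locality and scaling.** For a conformal rectangle `R`, mesh `δ > 0` and width
`σ > 0`, the probability that the configuration of positive values of the normalised field
`normNoise σ ξ` read at the medial points of the inner edges `innerEdges R.carrier δ` lies in the
crossing event of `R_δ` equals the crux's lattice term `P^latt_{σδ,δ}(R)`: the normalisation is a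
positive factor (`pl_normNoise_pos_iff`), `signConfig (σδ) δ = signConfig σ 1` (`signConfig_scale`),
the crossing event only depends on the inner edges (`mem_discreteCrossing_iff_of_inter_innerE_eq`),
and `innerEdges` enumerates them (`R` bounded, `lo_innerEdgeSet_finite`). -/
theorem stub_locality : ∀ R : Literature.Probability.RandomPlanarGeometry.ConformalRectangle, ∀ δ : ℝ, 0 < δ → ∀ σ : ℝ, 0 < σ → Literature.Probability.Percolation.latticeWhiteNoise.real {ξ | {e : Sym2 (Literature.Probability.LatticeModels.Site 2) | e ∈ innerEdges R.carrier δ ∧ 0 < normNoise σ ξ (Literature.Probability.LatticeModels.medialPoint 1 e)} ∈ Literature.Probability.Percolation.discreteCrossing R.carrier δ (R.arc 0) (R.arc 2)} = Literature.Probability.Percolation.smoothedCrossingProb (σ * δ) δ R.carrier (R.arc 0) (R.arc 2) := by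
  intro R δ hδ σ hσ
  rw [lo_event_eq_preimage (lo_innerEdgeSet_finite R hδ) hσ, smoothedCrossingProb,
    signConfig_scale hδ.ne', mul_div_cancel_right₀ σ hδ.ne']

end Summit.CriticalPhenomena.CardyFormulaZ2.Cruxes.DriftBound.Birth

end
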